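import Mathlib
import Summits.Ventures.HodgeRepro2.Tier7.Line3.OneVectorProjector

/-!
# Tier7/Line3/TwoVectorProjector — the integrated TWO-vector coefficient on the whole representation space
(seat t7-L1-p2, gen 3; memo v15 §2g′, the REVISED declaration of plan-3 l. 15352)

LINE 3 (t7-plan-3), version (ii), memo v15 §2g′: the line's test function at the compact place is the TWO-vector
coefficient `f_v(g) = d · conj⟨π⁰_v(g) u_B, u_A⟩` (`u_A`, `u_B` the two adapted weight vectors, `u_B = τ(h) u_A`),
NOT self-adjoint, and «on each copy `R(f_v) φ = ⟨φ, u_B⟩ u_A`, zero on `σ ≇ π⁰_v` ⇒ finite rank; the kernel identity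
runs on `FiniteRankAdjoint` (`R(f)† = R(f*)`, `f*` the coefficient with the vectors swapped)». THIS FILE proves the
whole-space statements for `f = mc τ b a` (`b = u_B` inside `τ g`, `a = u_A`; `OneVectorProjector.mc τ u w g =
d · ⟪τ g u, w⟫`, so in Mathlib's convention `mc τ b a g = d · ⟪τ g b, a⟫` = the memo's `f_v`), for EVERY unitary
strongly continuous representation `π` of the compact group on a Hilbert space `H` — no isotypic decomposition:

* `integratedForm_two_eq_PhiFun`: `R(f) x = PhiFun b x a` — the image of `a` under the equivariant map
  `PhiLM b x : V →ₗ[ℂ] H` (p677826's `pi_PhiFun`), so **`exists_copy_two`**: `R(f) x = 0` or `R(f) x = e a` for an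
  equivariant linear equivalence `e` of `V` onto a finite-dimensional `π`-stable subspace of `H`;
* **`integratedForm_two_map_eq`**: on every embedded copy `ι : V →ₗ[ℂ] H` of `τ`, `R(f) (ι v) = ⟪b, v⟫ • ι a` — the
  memo's «`R(f_v) φ = ⟨φ, u_B⟩ u_A`» (Mathlib's `⟪b, v⟫` = the physicists' `⟨v, u_B⟩`); **`integratedForm_two_map_eq_zero`**:
  `R(f) (ι w) = 0` on every embedded copy of an irreducible `σ ≇ τ` (p4's Schur orthogonality transported);
* **`integratedForm_two_integratedForm`**: `R(f) (R(f) x) = ⟪b, a⟫ • R(f) x` (idempotent exactly when `⟪b, a⟫ = 1`);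
* **`adjointFn_mc_swap`**: `f* = mc τ a b` (the coefficient with the vectors swapped), hence
  **`inner_integratedForm_two_eq`** / **`adjoint_RopTwo`**: `R(f)† = R(f*)` as bounded operators (row 692 +
  `CompactUnimodular`) — the input of p4's `FiniteRankAdjoint` for the line's `f`;
* **`mem_range_RopTwo_iff`** (`b ≠ 0`): the range of `R(f)` is EXACTLY the set of images of `a` under the equivariant
  maps `τ → π` — `R(f)` maps `H` onto the `u_A`-lines of the embedded copies of `τ`, and nothing else.

Conventions and dictionary as in `OneVectorProjector` (p677826). Nothing here is about (N). No sorry;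
axioms ⊆ {propext, Classical.choice, Quot.sound}.
-/

namespace Summit.Ventures.HodgeRepro2.Tier7.Line3.TwoVectorProjector

open MeasureTheory
open scoped InnerProductSpace
open Summit.Ventures.HodgeRepro2.T7SupportIntegratedForm (integratedForm integratedFormCLM integratedFormCLM_apply
  adjointFn inner_integratedForm_eq)
open Summit.Ventures.HodgeRepro2.Tier7.Line3.SchurProjector (IsIrreducible IsEquivIso inner_apply_inv
  integral_inner_smul_apply integral_inner_smul_apply_eq_zero)
open Summit.Ventures.HodgeRepro2.Tier7.Line3.OneVectorProjector

variable {G : Type*} [Group G] [TopologicalSpace G] [IsTopologicalGroup G] [CompactSpace G]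
  [MeasurableSpace G] [BorelSpace G] (μ : Measure G)
variable {V : Type*} [NormedAddCommGroup V] [InnerProductSpace ℂ V] [FiniteDimensional ℂ V] [CompleteSpace V]
variable {H : Type*} [NormedAddCommGroup H] [InnerProductSpace ℂ H] [CompleteSpace H]

omit [TopologicalSpace G] [IsTopologicalGroup G] [CompactSpace G] [BorelSpace G] [FiniteDimensional ℂ V]
  [CompleteSpace V] [CompleteSpace H] in
/-- **`R(f) x = PhiFun b x a`** for the two-vector `f = mc τ b a`. -/
theorem integratedForm_two_eq_PhiFun (π : G →* (H →ₗ[ℂ] H)) (τ : G →* (V →L[ℂ] V)) (b a : V) (x : H) :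
    integratedForm μ π (mc τ b a) x = PhiFun μ π τ b x a := rfl

omit [FiniteDimensional ℂ V] [CompleteSpace V] in
/-- **`R(f) x` lies in an embedded copy of `τ`, as the image of `a = u_A`**: either `R(f) x = 0`, or the range of
`PhiLM b x` is a copy of `τ` (an equivariant linear equivalence `e`) with `R(f) x = e a`. -/
theorem exists_copy_two [IsFiniteMeasure μ] [μ.IsMulLeftInvariant] {τ : G →* (V →L[ℂ] V)} (hτ : Continuous τ)
    (hτu : SchurProjector.IsUnitaryRep τ) (hτi : IsIrreducible τ) {π : G →* (H →ₗ[ℂ] H)}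
    (hπ : T7SupportWeightTorusOrbital.IsUnitaryRep π) (hc : ∀ x, Continuous fun g => π g x) (b a : V) (x : H) :
    integratedForm μ π (mc τ b a) x = 0 ∨
      ∃ e : V ≃ₗ[ℂ] LinearMap.range (PhiLM μ hτ hπ hc b x),
        (∀ k w, (e (τ k w) : H) = π k (e w)) ∧ (e a : H) = integratedForm μ π (mc τ b a) x := by
  rcases PhiLM_eq_zero_or_injective μ hτ hτu hτi hπ hc b x with h | h
  · left
    rw [integratedForm_two_eq_PhiFun, ← PhiLM_apply μ hτ hπ hc, h, LinearMap.zero_apply]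
  · right
    refine ⟨LinearEquiv.ofInjective _ h, fun k w => ?_, ?_⟩
    · simp only [LinearEquiv.ofInjective_apply, PhiLM_apply]
      exact (pi_PhiFun μ hτ hτu hπ hc b x k w).symm
    · simp only [LinearEquiv.ofInjective_apply, PhiLM_apply]
      rfl

/-- the `V`-valued integral of the two-vector coefficient against `τ`: `∫ mc τ b a g • τ g v dμ = ⟪b, v⟫ • a`
(p4's `SchurProjector.integral_inner_smul_apply`). -/
theorem integral_mc_two_smul_apply_eq [IsProbabilityMeasure μ] [μ.IsMulLeftInvariant] {τ : G →* (V →L[ℂ] V)}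
    (hτ : Continuous τ) (hτu : SchurProjector.IsUnitaryRep τ) (hτi : IsIrreducible τ) (b a v : V) :
    ∫ g, mc τ b a g • τ g v ∂μ = ⟪b, v⟫_ℂ • a := by
  have h := integral_inner_smul_apply μ τ hτ hτu hτi b v a
  have e : ∫ g, mc τ b a g • τ g v ∂μ = (Module.finrank ℂ V : ℂ) • ∫ g, ⟪τ g b, a⟫_ℂ • τ g v ∂μ := by
    rw [← integral_smul]
    congr 1
    funext g
    simp only [mc, mul_smul]
  rw [e, h, smul_smul]
  haveI := hτi.nontrivial
  have hd0 : (Module.finrank ℂ V : ℂ) ≠ 0 := by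
    exact_mod_cast (Module.finrank_pos (R := ℂ) (M := V)).ne'
  rw [mul_inv_cancel_left₀ hd0]

/-- **on every embedded copy of `τ`, `R(f)` is the rank-one operator `ι v ↦ ⟪b, v⟫ • ι a`** — the memo's
«`R(f_v) φ = ⟨φ, u_B⟩ u_A`». -/
theorem integratedForm_two_map_eq [IsProbabilityMeasure μ] [μ.IsMulLeftInvariant] {τ : G →* (V →L[ℂ] V)}
    (hτ : Continuous τ) (hτu : SchurProjector.IsUnitaryRep τ) (hτi : IsIrreducible τ) {π : G →* (H →ₗ[ℂ] H)}
    (b a : V) (ι : V →ₗ[ℂ] H) (hι : ∀ g v, ι (τ g v) = π g (ι v)) (v : V) :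
    integratedForm μ π (mc τ b a) (ι v) = ⟪b, v⟫_ℂ • ι a := by
  unfold integratedForm
  have e : ∀ g, mc τ b a g • π g (ι v) = LinearMap.toContinuousLinearMap ι (mc τ b a g • τ g v) := by
    intro g
    rw [map_smul, LinearMap.coe_toContinuousLinearMap', hι]
  simp_rw [e]
  rw [ContinuousLinearMap.integral_comp_comm _ (integrable_mc_smul_apply μ hτ b a v),
    integral_mc_two_smul_apply_eq μ hτ hτu hτi b a v, LinearMap.coe_toContinuousLinearMap', map_smul]

omit [FiniteDimensional ℂ V] [CompleteSpace V] in
/-- **on every embedded copy of an irreducible `σ ≇ τ`, `R(f)` vanishes**. -/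
theorem integratedForm_two_map_eq_zero {W : Type*} [NormedAddCommGroup W] [InnerProductSpace ℂ W]
    [CompleteSpace W] [IsFiniteMeasure μ] [μ.IsMulLeftInvariant] {τ : G →* (V →L[ℂ] V)} (hτ : Continuous τ)
    (hτu : SchurProjector.IsUnitaryRep τ) (hτi : IsIrreducible τ) (σ : G →* (W →L[ℂ] W)) (hσ : Continuous σ)
    (hσi : IsIrreducible σ) (hne : ¬ IsEquivIso σ τ) {π : G →* (H →ₗ[ℂ] H)} (b a : V) (ι : W →L[ℂ] H)
    (hι : ∀ g w, ι (σ g w) = π g (ι w)) (w : W) : integratedForm μ π (mc τ b a) (ι w) = 0 := by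
  unfold integratedForm
  have e : ∀ g, mc τ b a g • π g (ι w) = ι (mc τ b a g • σ g w) := by
    intro g
    rw [map_smul, hι]
  simp_rw [e]
  have hint : Integrable (fun g => mc τ b a g • σ g w) μ :=
    ((continuous_mc hτ b a).smul (hσ.clm_apply continuous_const)).integrable_of_hasCompactSupport
      (HasCompactSupport.of_compactSpace _)
  rw [ContinuousLinearMap.integral_comp_comm _ hint]
  have h2 : ∫ g, mc τ b a g • σ g w ∂μ = 0 := by
    have h0 := integral_inner_smul_apply_eq_zero μ σ τ hσ hτ hτu hσi hτi hne b w a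
    rw [← smul_zero (Module.finrank ℂ V : ℂ), ← h0, ← integral_smul]
    congr 1
    funext g
    simp only [mc, mul_smul]
  rw [h2, map_zero]

/-- **`R(f) (R(f) x) = ⟪b, a⟫ • R(f) x`** — through `PhiLM b x` and the rank-one formula; `R(f)` is idempotent
exactly when `⟪u_B, u_A⟫ = 1`. -/
theorem integratedForm_two_integratedForm [IsProbabilityMeasure μ] [μ.IsMulLeftInvariant] {τ : G →* (V →L[ℂ] V)}
    (hτ : Continuous τ) (hτu : SchurProjector.IsUnitaryRep τ) (hτi : IsIrreducible τ) {π : G →* (H →ₗ[ℂ] H)}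
    (hπ : T7SupportWeightTorusOrbital.IsUnitaryRep π) (hc : ∀ x, Continuous fun g => π g x) (b a : V) (x : H) :
    integratedForm μ π (mc τ b a) (integratedForm μ π (mc τ b a) x) =
      ⟪b, a⟫_ℂ • integratedForm μ π (mc τ b a) x := by
  rw [integratedForm_two_eq_PhiFun μ π τ b a x]
  show (∫ g, mc τ b a g • π g (PhiFun μ π τ b x a) ∂μ) = ⟪b, a⟫_ℂ • PhiFun μ π τ b x a
  have e : ∀ g, mc τ b a g • π g (PhiFun μ π τ b x a) =
      LinearMap.toContinuousLinearMap (PhiLM μ hτ hπ hc b x) (mc τ b a g • τ g a) := by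
    intro g
    rw [map_smul, LinearMap.coe_toContinuousLinearMap', PhiLM_apply, pi_PhiFun μ hτ hτu hπ hc b x g a]
  simp_rw [e]
  rw [ContinuousLinearMap.integral_comp_comm _ (integrable_mc_smul_apply μ hτ b a a),
    integral_mc_two_smul_apply_eq μ hτ hτu hτi b a a, LinearMap.coe_toContinuousLinearMap', map_smul, PhiLM_apply]

omit [TopologicalSpace G] [IsTopologicalGroup G] [CompactSpace G] [MeasurableSpace G] [BorelSpace G]
  [FiniteDimensional ℂ V] [CompleteSpace V] in
/-- **`f* = mc τ a b`**: the adjoint function of the two-vector coefficient is the coefficient with the vectors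
swapped (unitarity of `τ`). -/
theorem adjointFn_mc_swap {τ : G →* (V →L[ℂ] V)} (hτu : SchurProjector.IsUnitaryRep τ) (b a : V) :
    adjointFn (mc τ b a) = mc τ a b := by
  funext g
  unfold adjointFn mc
  rw [map_mul, map_natCast, inner_conj_symm, inner_apply_inv τ hτu g a b]

/-- `R(f)` as a bounded operator for the two-vector `f = mc τ b a` (row 692's `integratedFormCLM`). -/
noncomputable def RopTwo [IsFiniteMeasure μ] {τ : G →* (V →L[ℂ] V)} (hτ : Continuous τ) {π : G →* (H →ₗ[ℂ] H)}
    (hπ : T7SupportWeightTorusOrbital.IsUnitaryRep π) (hc : ∀ x, Continuous fun g => π g x) (b a : V) :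
    H →L[ℂ] H :=
  integratedFormCLM μ hπ (isStronglyMeasurable_of_continuous μ hc) (integrable_mc μ hτ b a)

omit [IsTopologicalGroup G] [FiniteDimensional ℂ V] [CompleteSpace V] [CompleteSpace H] in
/-- `RopTwo b a x = R(mc τ b a) x`. -/
theorem RopTwo_apply [IsFiniteMeasure μ] {τ : G →* (V →L[ℂ] V)} (hτ : Continuous τ) {π : G →* (H →ₗ[ℂ] H)}
    (hπ : T7SupportWeightTorusOrbital.IsUnitaryRep π) (hc : ∀ x, Continuous fun g => π g x) (b a : V) (x : H) :
    RopTwo μ hτ hπ hc b a x = integratedForm μ π (mc τ b a) x := rfl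

omit [FiniteDimensional ℂ V] [CompleteSpace V] in
/-- **`⟪R(f) x, y⟫ = ⟪x, R(f*) y⟫` with `f* = mc τ a b`** (row 692's adjoint formula; `μ` inversion-invariant by
`CompactUnimodular`). -/
theorem inner_integratedForm_two_eq [μ.IsHaarMeasure] [IsProbabilityMeasure μ] {τ : G →* (V →L[ℂ] V)}
    (hτ : Continuous τ) (hτu : SchurProjector.IsUnitaryRep τ) {π : G →* (H →ₗ[ℂ] H)}
    (hπ : T7SupportWeightTorusOrbital.IsUnitaryRep π) (hc : ∀ x, Continuous fun g => π g x) (b a : V) (x y : H) :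
    ⟪integratedForm μ π (mc τ b a) x, y⟫_ℂ = ⟪x, integratedForm μ π (mc τ a b) y⟫_ℂ := by
  haveI := CompactUnimodular.isInvInvariant_of_compactSpace μ
  rw [← adjointFn_mc_swap hτu b a]
  exact inner_integratedForm_eq μ hπ (isStronglyMeasurable_of_continuous μ hc) (integrable_mc μ hτ b a)
    (by rw [adjointFn_mc_swap hτu b a]; exact integrable_mc μ hτ a b) x y

omit [FiniteDimensional ℂ V] [CompleteSpace V] in
/-- **`R(f)† = R(f*)`**: the adjoint of the two-vector operator is the operator of the swapped coefficient — the
input of p4's `FiniteRankAdjoint` for the line's `f`. -/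
theorem adjoint_RopTwo [μ.IsHaarMeasure] [IsProbabilityMeasure μ] {τ : G →* (V →L[ℂ] V)} (hτ : Continuous τ)
    (hτu : SchurProjector.IsUnitaryRep τ) {π : G →* (H →ₗ[ℂ] H)} (hπ : T7SupportWeightTorusOrbital.IsUnitaryRep π)
    (hc : ∀ x, Continuous fun g => π g x) (b a : V) :
    ContinuousLinearMap.adjoint (RopTwo μ hτ hπ hc b a) = RopTwo μ hτ hπ hc a b := by
  symm
  rw [ContinuousLinearMap.eq_adjoint_iff]
  intro x y
  rw [RopTwo_apply, RopTwo_apply]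
  exact inner_integratedForm_two_eq μ hτ hτu hπ hc a b x y

/-- **the range of `R(f)`, exactly** (`b ≠ 0`): `y ∈ range R(f) ↔ y = ι a` for an equivariant `ι : V →ₗ[ℂ] H` —
`R(f)` maps `H` onto the `u_A`-vectors of the embedded copies of `τ`. -/
theorem mem_range_RopTwo_iff [IsProbabilityMeasure μ] [μ.IsMulLeftInvariant] {τ : G →* (V →L[ℂ] V)}
    (hτ : Continuous τ) (hτu : SchurProjector.IsUnitaryRep τ) (hτi : IsIrreducible τ) {π : G →* (H →ₗ[ℂ] H)}
    (hπ : T7SupportWeightTorusOrbital.IsUnitaryRep π) (hc : ∀ x, Continuous fun g => π g x) {b : V} (hb : b ≠ 0)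
    (a : V) (y : H) :
    y ∈ LinearMap.range (RopTwo μ hτ hπ hc b a : H →ₗ[ℂ] H) ↔
      ∃ ι : V →ₗ[ℂ] H, (∀ g v, ι (τ g v) = π g (ι v)) ∧ ι a = y := by
  constructor
  · rintro ⟨x, rfl⟩
    exact ⟨PhiLM μ hτ hπ hc b x, fun g v => by
      rw [PhiLM_apply, PhiLM_apply, pi_PhiFun μ hτ hτu hπ hc b x g v], rfl⟩
  · rintro ⟨ι, hι, rfl⟩
    refine ⟨ι ((⟪b, b⟫_ℂ)⁻¹ • b), ?_⟩
    show integratedForm μ π (mc τ b a) (ι ((⟪b, b⟫_ℂ)⁻¹ • b)) = ι a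
    rw [integratedForm_two_map_eq μ hτ hτu hτi b a ι hι, inner_smul_right,
      inv_mul_cancel₀ (inner_self_ne_zero.2 hb), one_smul]

end Summit.Ventures.HodgeRepro2.Tier7.Line3.TwoVectorProjector
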